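import Summits.Langlands.Langlands.Theses.IrreducibilityBySelfDuality
import Summits.Langlands.Langlands.Theorems.IrreducibilityBySelfDualityHeckeEigenvalueFieldRationalStructure
import Literature.NumberTheory.Automorphic.CuspidalCohomologyGL
import Literature.NumberTheory.Automorphic.AutomorphicRepsGLSatakeFlathProofs
import Mathlib.Analysis.Calculus.DifferentialForm.Basic

/-!
# Crux `HeckeEigenvalueField` (stmt-Langlands-13632) — ideator 1 sketch (round 1)

First-lemma signatures for two crux idea cards:

* §A/§B/§C — card `weil-restriction-occurrence`: the coefficient system of `Res_{K/ℚ} GL_n` of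
  multi-weight `Λ = (λ_σ)_σ` on the tree's `TwistedQuotient` carrier for ANY number field `K`
  (`resCoeffRep`), the Betti OCCURRENCE statements `Occurs` (ℂ-coefficients; what analysis proves)
  and `OccursRational` (`ℂ ⊗_E` Betti form; Clozel p.122–123 / Grobner–Raghuram Lemma 38 +
  Prop. 41), and the glue `crux_of_occursRational : OccursRational → HeckeEigenvalueField`
  (PROVED here from the landed `heckeEigenvalueField_of_rationalStructure`).
* §D — card `cone-cube-self-regularizing`: the cone-cube parametrisation of straight simplices in a
  real vector space (`coneCube`), its equivariance under LINEAR maps (proved: the lever — `GL_n(K_∞)`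
  acts linearly on the cone of positive hermitian forms), convexity (proved), and the signature of
  the cocycle identity for closed forms (`conePeriod_cocycle`, Stokes on the unit cube; sorried).
-/

set_option linter.dupNamespace false
set_option linter.unusedVariables false

noncomputable section

open scoped TensorProduct Classical
open Literature.NumberTheory.Automorphic Literature.NumberTheory.DiophantineGeometry
open NumberField IsDedekindDomain Filter

namespace Summit.Langlands.Langlands.Cruxes.HeckeEigenvalueField.SketchIdeator1

/-! ## §A. The coefficient system `V_Λ(k) = ⨂_σ V_{λ_σ}(k) ∘ σ` of `Res_{K/ℚ} GL_n` -/

section Coeff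

variable (k : Type) [Field k] (n : ℕ) (K : Type) [Field K]

/-- `V_Λ(k) := ⨂_{σ : K →+* k} V_{Λ σ}(k)` — the algebraic coefficient module of multi-weight
`Λ = (λ_σ)_σ` (one dominant weight per embedding `σ` of `K` into the coefficient field `k`;
`V_λ(k)` = the tree's `GLnCohomology.CoeffModule k n λ`, a Weyl module twisted by a power of `det`). -/
abbrev ResCoeffModule (Λ : (K →+* k) → Fin n → ℤ) : Type :=
  ⨂[k] σ : (K →+* k), GLnCohomology.CoeffModule k n (Λ σ)

/-- The representation of the ABSTRACT group `GL_n(K)` on `V_Λ(k)`: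
`g ↦ ⨂_σ V_{λ_σ}(σ(g))` — the restriction to `GL_n(K) = (Res_{K/ℚ} GL_n)(ℚ)` of the irreducible
algebraic representation of `Res_{K/ℚ} GL_n ×_ℚ k = ∏_σ GL_n` of highest weight `Λ`.  Defined over
`k` as soon as `k` receives the embeddings one wants (e.g. `k = ℂ`, or `k ⊇` the Galois closure). -/
def resCoeffRep (Λ : (K →+* k) → Fin n → ℤ) :
    Representation k (GL (Fin n) K) (ResCoeffModule k n K Λ) :=
  PiTensorProduct.mapMonoidHom.comp
    (MonoidHom.pi fun σ : K →+* k =>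
      (GLnCohomology.coeffRepGL k n (Λ σ)).comp (Matrix.GeneralLinearGroup.map (σ : K →+* k)))

end Coeff

/-! ## §B. Betti occurrence of a regular algebraic cuspidal eigensystem, over any `K` -/

section Occurrence

/-- **`Occurs`** (ℂ-coefficients) — Eichler–Shimura–Borel EXISTENCE for `Res_{K/ℚ} GL_n`, every
number field `K`: a cuspidal regular algebraic `π` on `GL_n(𝔸_K)` with a `K(𝔫)`-fixed vector has,
for some multi-weight `Λ` and some degree `q`, a NON-ZERO simultaneous eigenclass of the double-coset
operators `T_{v,i} = [K_f(𝔫) t_{v,i} K_f(𝔫)]`, `v ∤ 𝔫`, in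
`H^q(GL_n(K), Fun(GL_n(𝔸_K^∞)/K_f(𝔫), V_Λ(ℂ)))` (the tree's `TwistedQuotient.cohomology`) with the
Satake–Tamagawa eigenvalues `q_v^{i(n-i)/2} e_i(α_v)`.  Generalises the tree's named facts
`GLnCohomology.cuspidalEigenclass_exists` (`K = ℚ`) and
`bianchi_cuspidal_regularLAlgebraic_eigenclassExists` (`n = 2`, `K` imaginary quadratic); FULL
cohomology (no interior part, no bottom degree, no exhaustion, no multiplicity) — all the weak
clause of Clozel 3.13 needs. -/
def Occurs : Prop :=
  ∀ (n : ℕ) (K : Type) [Field K] [NumberField K] (hcpt : isCompact_glFiniteIntegralLevel n K)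
    (𝔫 : Ideal (𝓞 K)), 𝔫 ≠ 0 → 1 ≤ n →
    ∀ π : CuspidalAutomorphicRepData n K hcpt, π.1.IsRegularAlgebraic →
      (∃ φ ∈ π.1.W, φ ∉ π.1.W' ∧
        ∀ u ∈ principalCongruenceLevel n K 𝔫, rightTranslation (AdelicGroupData.gl n K) u φ = φ) →
      ∃ (Λ : (K →+* ℂ) → Fin n → ℤ) (q : ℕ)
        (x : TwistedQuotient.cohomology (V := ResCoeffModule ℂ n K Λ) (BigHeckeGLn.globalEmbedding n K)
          (finitePrincipalCongruenceLevel n K 𝔫) (resCoeffRep ℂ n K Λ) q),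
        x ≠ 0 ∧ ∀ v : HeightOneSpectrum (𝓞 K), ¬ v.asIdeal ∣ 𝔫 →
          ∀ α : Multiset ℂ, π.1.HasSatakeParamAt v α → ∀ i ≤ n,
            TwistedQuotient.heckeEnd (V := ResCoeffModule ℂ n K Λ) (BigHeckeGLn.globalEmbedding n K)
                (finitePrincipalCongruenceLevel n K 𝔫) (resCoeffRep ℂ n K Λ)
                (BigHeckeGLn.heckeElement n K v i) q x =
              (((((Real.sqrt (v.residueCard : ℝ)) : ℝ) : ℂ) ^ (i * (n - i))) * α.esymm i) • x

/-- **`OccursRational`** (`ℂ ⊗_E` Betti form; Clozel 1990 pp. 122–123, Grobner–Raghuram 2014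
Lemma 37–38 + Prop. 41: `H^q(S_{K_f}, ℰ_μ) ≅ H^q_B(S_{K_f}, E_{μ,ℚ(μ)}) ⊗_{ℚ(μ)} ℂ ⊇ π_f^{K_f}`):
the same occurrence, with the class in `ℂ ⊗_E H^q(GL_n(K), Fun(GL_n(𝔸_K^∞)/K_f(𝔫), V_Λ(E)))` for a
number field `E ⊂ ℂ` over which the coefficient system is defined (any `E` containing the Galois
closure of `K`), the Hecke operators being the base changes of the `E`-linear ones.  This is the
TRANSFER target `C⁺` of card `weil-restriction-occurrence`; `Occurs` + universal coefficients ⇒ it. -/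
def OccursRational : Prop :=
  ∀ (n : ℕ) (K : Type) [Field K] [NumberField K] (hcpt : isCompact_glFiniteIntegralLevel n K)
    (𝔫 : Ideal (𝓞 K)), 𝔫 ≠ 0 → 1 ≤ n →
    ∀ π : CuspidalAutomorphicRepData n K hcpt, π.1.IsRegularAlgebraic →
      (∃ φ ∈ π.1.W, φ ∉ π.1.W' ∧
        ∀ u ∈ principalCongruenceLevel n K 𝔫, rightTranslation (AdelicGroupData.gl n K) u φ = φ) →
      ∃ (E : Subfield ℂ) (_ : FiniteDimensional ℚ E) (Λ : (K →+* E) → Fin n → ℤ) (q : ℕ)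
        (x : ℂ ⊗[E] (TwistedQuotient.cohomology (V := ResCoeffModule E n K Λ)
          (BigHeckeGLn.globalEmbedding n K) (finitePrincipalCongruenceLevel n K 𝔫)
          (resCoeffRep E n K Λ) q)),
        x ≠ 0 ∧ ∀ v : HeightOneSpectrum (𝓞 K), ¬ v.asIdeal ∣ 𝔫 →
          ∀ α : Multiset ℂ, π.1.HasSatakeParamAt v α → ∀ i ≤ n,
            (TwistedQuotient.heckeEnd (V := ResCoeffModule E n K Λ) (BigHeckeGLn.globalEmbedding n K)
                (finitePrincipalCongruenceLevel n K 𝔫) (resCoeffRep E n K Λ)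
                (BigHeckeGLn.heckeElement n K v i) q).baseChange ℂ x =
              (((((Real.sqrt (v.residueCard : ℝ)) : ℝ) : ℂ) ^ (i * (n - i))) * α.esymm i) • x

end Occurrence

/-! ## §C. Glue: `OccursRational → HeckeEigenvalueField` (card `weil-restriction-occurrence`) -/

section Glue

/-- Trivial realisation data (used when the eigenvalue statement is vacuous: `n = 0`, where the only
eigenvalue is `e₀(α) = 1`, or a datum with no Satake parameter anywhere): `E₀ = ℚ ⊂ ℂ`, `V = E₀`,
`x = 1 ⊗ 1 ≠ 0`, and `T = id` realises the eigenvalue `1`. [folklore] -/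
theorem exists_trivial_realisation :
    ∃ (E₀ : Subfield ℂ) (_ : FiniteDimensional ℚ E₀) (V : Type) (_ : AddCommGroup V)
      (_ : Module E₀ V) (x : ℂ ⊗[E₀] V), x ≠ 0 ∧ ∃ T : V →ₗ[E₀] V, T.baseChange ℂ x = (1 : ℂ) • x := by
  let E₀ : IntermediateField ℚ ℂ := ⊥
  have hE₀ : FiniteDimensional ℚ E₀ := inferInstance
  let S : Subfield ℂ := E₀.toSubfield
  refine ⟨S, hE₀, S, inferInstance, inferInstance, (1 : ℂ) ⊗ₜ[S] (1 : S), ?_, LinearMap.id, ?_⟩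
  · intro h
    have h1 := congrArg (TensorProduct.rid S ℂ) h
    rw [TensorProduct.rid_tmul, one_smul, map_zero] at h1
    exact one_ne_zero h1
  · rw [LinearMap.baseChange_id, LinearMap.id_apply, one_smul]

open Summit.Langlands.Langlands.Theorems.HeckeEigenvalueField in
/-- **The crux from rational Betti occurrence.**  The level `𝔫` and the `K(𝔫)`-fixed vector come
from unramifiedness at ONE place (the definition of `HasSatakeParamAt`; if `π` has no Satake
parameter anywhere the statement is vacuous); the `E`-vector space fed to the landed
dimension-free reduction `heckeEigenvalueField_of_rationalStructure` is the `E`-cohomology itself,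
the operators the `T_{v,i}`; `∀ᶠ v` because only finitely many `v` divide `𝔫`
(`Ideal.finite_factors`); `n = 0` is vacuous-true (only `i = 0`, eigenvalue `e₀(α) = 1`). -/
theorem crux_of_occursRational (hocc : OccursRational) :
    Summit.Langlands.Langlands.Theses.IrreducibilityBySelfDuality.HeckeEigenvalueField := by
  refine heckeEigenvalueField_of_rationalStructure ?_
  intro n K _ _ hcpt π hπ
  rcases Nat.eq_zero_or_pos n with hn | hn
  · -- `n = 0`: the only `i ≤ 0` is `0`, eigenvalue `(√q)^0 · e₀(α) = 1`
    subst hn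
    obtain ⟨E₀, hE₀, V, _, _, x, hx, T, hT⟩ := exists_trivial_realisation
    refine ⟨E₀, hE₀, V, inferInstance, inferInstance, x, hx, ?_⟩
    refine Filter.Eventually.of_forall fun v α hα i hi => ⟨T, ?_⟩
    obtain rfl : i = 0 := Nat.le_zero.mp hi
    rw [hT]
    simp [Multiset.esymm, Multiset.powersetCard_zero_left]
  -- `n ≥ 1`.  Either `π` has a Satake parameter somewhere (then that place hands us a level `𝔫 ≠ 0`
  -- and a `K(𝔫)`-fixed `φ ∈ W ∖ W'`), or the statement is vacuous.
  by_cases hex : ∃ (v₀ : HeightOneSpectrum (𝓞 K)) (α₀ : Multiset ℂ), π.1.HasSatakeParamAt v₀ α₀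
  swap
  · push_neg at hex
    obtain ⟨E₀, hE₀, V, _, _, x, hx, T, hT⟩ := exists_trivial_realisation
    refine ⟨E₀, hE₀, V, inferInstance, inferInstance, x, hx, ?_⟩
    exact Filter.Eventually.of_forall fun v α hα => (hex v α hα).elim
  obtain ⟨v₀, α₀, hα₀⟩ := hex
  obtain ⟨𝔫, ϖ, h𝔫, -, -, -, φ, hφW, hφW', hφfix, -⟩ := hα₀
  obtain ⟨E, hE, Λ, q, x, hx, heig⟩ := hocc n K hcpt 𝔫 h𝔫 hn π hπ ⟨φ, hφW, hφW', hφfix⟩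
  refine ⟨E, hE, _, inferInstance, inferInstance, x, hx, ?_⟩
  have hfin : {v : HeightOneSpectrum (𝓞 K) | v.asIdeal ∣ 𝔫}.Finite := Ideal.finite_factors h𝔫
  refine (Filter.eventually_cofinite.mpr (hfin.subset ?_))
  intro v hv
  by_contra hdvd
  exact hv fun α hα i hi => ⟨_, heig v hdvd α hα i hi⟩

end Glue

/-! ## §D. Cone-cubes: straight simplices in a real vector space, parametrised by the unit cube
(card `cone-cube-self-regularizing`) -/

section ConeCube

variable {W : Type*} [AddCommGroup W] [Module ℝ W]

/-- The **cone-cube**: `κ(x₀,…,x_q)(t₁,…,t_q) = (1-t₁) x₀ + t₁ κ(x₁,…,x_q)(t₂,…,t_q)` — the straight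
`q`-simplex `[x₀,…,x_q]` parametrised by `[0,1]^q` (iterated join), the device of Eilenberg / Dupont
/ the Eisenstein-cocycle literature (Sczech, Charollois–Dasgupta) for producing group cochains by
integration. -/
def coneCube : (q : ℕ) → (Fin (q + 1) → W) → (Fin q → ℝ) → W
  | 0, x, _ => x 0
  | q + 1, x, t => (1 - t 0) • x 0 + t 0 • coneCube q (fun i => x i.succ) (fun j => t j.succ)

/-- **The lever: equivariance is free.**  For a LINEAR map `A` (e.g. `H ↦ g H g*`, the action of
`GL_n(K_w)` on hermitian forms), `κ(A x₀, …, A x_q) = A ∘ κ(x₀, …, x_q)`: straight simplices of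
translated vertices are the translates — no geodesics, no Riemannian geometry. [PROVED] -/
theorem coneCube_comp_linear (A : W →ₗ[ℝ] W) :
    ∀ (q : ℕ) (x : Fin (q + 1) → W) (t : Fin q → ℝ), coneCube q (⇑A ∘ x) t = A (coneCube q x t)
  | 0, x, t => rfl
  | q + 1, x, t => by
      simp only [coneCube, Function.comp_apply, map_add, map_smul]
      congr 1
      rw [← coneCube_comp_linear A q (fun i => x i.succ) (fun j => t j.succ)]
      rfl

/-- Cone-cubes of points of a CONVEX set stay in it (for cube parameters in `[0,1]`): the open cone
of positive definite hermitian forms is convex, so cusp-form-valued differential forms, smooth on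
the cone, are smooth on every cone-cube. [PROVED] -/
theorem coneCube_mem_of_convex {X : Set W} (hX : Convex ℝ X) :
    ∀ (q : ℕ) {x : Fin (q + 1) → W} (_ : ∀ i, x i ∈ X) {t : Fin q → ℝ}
      (_ : ∀ j, t j ∈ Set.Icc (0 : ℝ) 1), coneCube q x t ∈ X
  | 0, x, hx, t, _ => hx 0
  | q + 1, x, hx, t, ht => by
      simp only [coneCube]
      have h0 := ht 0
      exact hX (hx 0) (coneCube_mem_of_convex hX q (fun i => hx i.succ) (fun j => ht j.succ))
        (by linarith [h0.2]) h0.1 (by ring)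

variable {V : Type*} [NormedAddCommGroup V] [NormedSpace ℝ V] [FiniteDimensional ℝ V]
  {F : Type*} [NormedAddCommGroup F] [NormedSpace ℝ F] [CompleteSpace F]

/-- The **cone period** of an `F`-valued `q`-form `ω` on `V` over the straight simplex
`[x₀,…,x_q]`: `∫_{[0,1]^q} κ*ω`, i.e. `ω` at `κ(t)` evaluated on the `q` partial derivatives
`∂κ/∂t_j`. -/
def conePeriod (q : ℕ) (ω : V → V [⋀^Fin q]→L[ℝ] F) (x : Fin (q + 1) → V) : F :=
  ∫ t in Set.pi Set.univ (fun _ : Fin q => Set.Icc (0 : ℝ) 1),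
    ω (coneCube q x t) (fun j => fderiv ℝ (coneCube q x) t (Pi.single j 1))

/-- **Cone periods of a CLOSED form are a cocycle** (signature; the first checkable statement of the
`cone-cube-self-regularizing` line): for `ω` smooth with `dω = 0` on an open convex `X` and
`q + 2` points of `X`, the alternating sum of the cone periods over the faces of `[x₀,…,x_{q+1}]`
vanishes — Stokes on the unit cube `[0,1]^{q+1}` for the pulled-back form
(Mathlib: `extDeriv_pullback` + the box divergence theorem). Combined with `coneCube_comp_linear`
this makes `(g₀,…,g_q) ↦ conePeriod ω (gᵢ • x₀)` a homogeneous GROUP cocycle for every closed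
equivariant form — the explicit de Rham → group-cohomology map `I` of the line. -/
theorem conePeriod_cocycle {X : Set V} (hXo : IsOpen X) (hXc : Convex ℝ X) (q : ℕ)
    (ω : V → V [⋀^Fin (q + 1)]→L[ℝ] F) (hω : ContDiffOn ℝ ⊤ ω X)
    (hclosed : ∀ y ∈ X, extDeriv ω y = 0) (x : Fin (q + 3) → V) (hx : ∀ i, x i ∈ X) :
    ∑ i : Fin (q + 3), (-1 : ℝ) ^ (i : ℕ) • conePeriod (q + 1) ω (fun j => x (i.succAbove j)) = 0 := by
  sorry

end ConeCube

end Summit.Langlands.Langlands.Cruxes.HeckeEigenvalueField.SketchIdeator1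

end
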